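import Literature.NumberTheory.EllipticCurves.BigGaloisRepSelmer
import Literature.NumberTheory.GaloisRepresentations.LocalGaloisGroupProofs
import Mathlib.LinearAlgebra.Matrix.Charpoly.LinearMap
import HarnessLib

/-!
# Crux 4 `BSDpOnCellC` (stmt-BirchSwinnertonDyer-19034), line «telescope» v10, leaf N2|pub sub-leaf W2 (and leaf N3′):
# the FROBENIUS-ANNIHILATOR input (ann) REDUCED to cofinite generation of `A^{I_w}/c·A^{I_w}` — Cayley–Hamilton through Pontryagin duality
# (successor LEAD `cruxlead-19034` g3; `--supports`, helper; THEOREMS ONLY; generic in the coefficient ring; closes no registered stub)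

HONEST FRAMING. No registered stub, no crux, no summit statement is proved; BSD is proved for no curve. After this gen's
`TelescopeK2WeightTwoControlOfPubOfSubleaves.weightTwoControlOfPub_of_controlMap_of_purity` (p754678) the registered leaf N2|pub rests on
W2 and W4; width x2-p2 g19's `TelescopeK2WeightTwoControlMapOfFrobenius.exists_weightTwoControlMap_of_frobenius_of_heegner` (p752662) gives
W2 on the split branch from N1-shaped fibre data plus ONE typed input (ann): «for `w ∈ S₀`, `w ∤ p`, `d ∈ Γ_{K_w}` there is a MONIC
`P ∈ ℤ_p⟦X⟧[Y]` with `P(ρ₂(res d))·A₂^{I_w} ⊆ X·A₂^{I_w}`». This file proves (ann) — for ANY coefficient ring `S`, representation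
`ρ : Γ_K → Aut_S(A)`, scalar `c` and `d ∈ Γ_{K_w}` — from the single finiteness statement «the Pontryagin dual of `A^{I_w}/c·A^{I_w}` is a
finitely generated `S`-module» (classically: `A₂^{I_w}/X·A₂^{I_w} ↪ H¹(I_w, A₂[X])`, cofinitely generated over `ℤ_p` at `w ∤ p`; that
injection and the cofinite generation of `H¹(I_w, A₂[X])` are NOT proved here). The same lemma serves leaf N3′ (`π_k = X − x_k` for `c`).

* §1 `comp_aeval_of_comp_eq` — `g ∘ P(f₁) = P(f₂) ∘ g` whenever `g ∘ f₁ = f₂ ∘ g` (naturality of `Polynomial.aeval` on `Module.End`).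
* §2 `dual_aeval`, `dual_eq_zero_iff`, **`exists_monic_aeval_eq_zero_of_finite_characterModule`** — an endomorphism of a module whose
  Pontryagin dual is finitely generated is killed by a MONIC polynomial (Cayley–Hamilton `LinearMap.exists_monic_and_aeval_eq_zero` for the
  dual endomorphism, pulled back through `CharacterModule.dual`, which is injective on maps because characters separate points).
* §3 **`exists_monic_forall_exists_smul_eq_aeval`** — descent to `V/c·V`: for `φ` preserving a submodule `V` with `(V/c·V)^∨` finitely
  generated, a monic `P` with `P(φ)·V ⊆ c·V`.
* §4 **`frobeniusAnnihilator_of_finite`** — the (ann) clause of p752662 VERBATIM in its quantifier shape, for `V = A^{I_w}` (the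
  `ρ(res I_w)`-invariants; `ρ(res d)` preserves them because `I_w ⊲ Γ_{K_w}`), from
  `Module.Finite S (CharacterModule (A^{I_w} ⧸ c·A^{I_w}))`.

References: N. Bourbaki, Algèbre commutative VII–IX / Alg. Comm. (Cayley–Hamilton for finitely generated modules) [BourbakiAC5to7];
R. Greenberg, in: LNM 1716 (1999) §4 (cofinitely generated `Λ`-modules and Pontryagin duality) [Greenberg1999LNM];
Jetchev–Skinner–Wan, Camb. J. Math. 5 (2017) §3.4 (the local terms at `w ∤ p`) [JetchevSkinnerWan2017].
-/

set_option autoImplicit false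
set_option linter.dupNamespace false

noncomputable section

open Polynomial

namespace Summit.BirchSwinnertonDyer.BirchSwinnertonDyer.Theorems.TelescopeK2FrobeniusAnnihilator

/-! ## §1 Naturality of `aeval` on endomorphisms -/

/-- If `g ∘ f₁ = f₂ ∘ g` then `g ∘ P(f₁) = P(f₂) ∘ g` for every polynomial `P`. [folklore] -/
theorem comp_aeval_of_comp_eq {S : Type*} [CommRing S] {M₁ M₂ : Type*} [AddCommGroup M₁] [Module S M₁]
    [AddCommGroup M₂] [Module S M₂] (g : M₁ →ₗ[S] M₂) (f₁ : Module.End S M₁) (f₂ : Module.End S M₂)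
    (h : g ∘ₗ f₁ = f₂ ∘ₗ g) (P : S[X]) : g ∘ₗ aeval f₁ P = aeval f₂ P ∘ₗ g := by
  induction P using Polynomial.induction_on with
  | C a =>
    rw [aeval_C, aeval_C, Module.algebraMap_end_eq_smul_id, Module.algebraMap_end_eq_smul_id,
      LinearMap.comp_smul, LinearMap.smul_comp, LinearMap.comp_id, LinearMap.id_comp]
  | add p q hp hq => rw [map_add, map_add, LinearMap.comp_add, LinearMap.add_comp, hp, hq]
  | monomial n a ih =>
    have e₁ : aeval f₁ (C a * X ^ (n + 1)) = aeval f₁ (C a * X ^ n) * f₁ := by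
      rw [pow_succ, ← mul_assoc, aeval_mul, aeval_X]
    have e₂ : aeval f₂ (C a * X ^ (n + 1)) = aeval f₂ (C a * X ^ n) * f₂ := by
      rw [pow_succ, ← mul_assoc, aeval_mul, aeval_X]
    rw [e₁, e₂, Module.End.mul_eq_comp, Module.End.mul_eq_comp, ← LinearMap.comp_assoc, ih, LinearMap.comp_assoc, h,
      ← LinearMap.comp_assoc]

/-! ## §2 Cayley–Hamilton through Pontryagin duality -/

section Dual

variable {R : Type*} [CommRing R] {M N : Type*} [AddCommGroup M] [Module R M] [AddCommGroup N] [Module R N]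

/-- `CharacterModule.dual` is injective on linear maps: characters separate points. [folklore] -/
theorem dual_eq_zero_iff (f : M →ₗ[R] N) : CharacterModule.dual f = 0 ↔ f = 0 := by
  refine ⟨fun h => ?_, fun h => by rw [h, CharacterModule.dual_zero]⟩
  ext m
  refine CharacterModule.eq_zero_of_character_apply fun c => ?_
  exact congrArg (fun g : CharacterModule N →ₗ[R] CharacterModule M => g c m) h

/-- `dual` is additive on maps. [folklore] -/
theorem dual_add (f g : M →ₗ[R] N) :
    CharacterModule.dual (f + g) = CharacterModule.dual f + CharacterModule.dual g := by
  ext c m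
  change c ((f + g) m) = c (f m) + c (g m)
  rw [LinearMap.add_apply, map_add]

/-- `dual` is `R`-homogeneous on maps. [folklore] -/
theorem dual_smul (a : R) (f : M →ₗ[R] N) :
    CharacterModule.dual (a • f) = a • CharacterModule.dual f := by
  ext c m
  change c ((a • f) m) = c (f (a • m))
  rw [LinearMap.smul_apply, LinearMap.map_smul]

/-- `dual (φ ^ n) = (dual φ) ^ n`. [folklore] -/
theorem dual_pow (φ : Module.End R M) (n : ℕ) :
    CharacterModule.dual (φ ^ n) = CharacterModule.dual φ ^ n := by
  induction n with
  | zero =>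
    ext c m
    rfl
  | succ n ih =>
    rw [pow_succ, Module.End.mul_eq_comp, CharacterModule.dual_comp, ih, ← Module.End.mul_eq_comp, ← pow_succ']

/-- `dual (P(φ)) = P(dual φ)`. [folklore] -/
theorem dual_aeval (φ : Module.End R M) (P : R[X]) :
    CharacterModule.dual (aeval φ P) = aeval (CharacterModule.dual φ) P := by
  induction P using Polynomial.induction_on' with
  | add p q hp hq => rw [map_add, map_add, dual_add, hp, hq]
  | monomial n a =>
    rw [← C_mul_X_pow_eq_monomial, aeval_mul, aeval_C, map_pow, aeval_X, aeval_mul, aeval_C, map_pow, aeval_X,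
      Algebra.algebraMap_eq_smul_one, Algebra.algebraMap_eq_smul_one, smul_mul_assoc, smul_mul_assoc, one_mul, one_mul,
      dual_smul, dual_pow]

/-- **Cayley–Hamilton through Pontryagin duality.** An endomorphism of an `R`-module whose Pontryagin dual is a finitely
generated `R`-module is killed by a MONIC polynomial over `R`. [cite: BourbakiAC5to7, Alg. Comm. (Cayley–Hamilton for modules)] -/
theorem exists_monic_aeval_eq_zero_of_finite_characterModule [Module.Finite R (CharacterModule M)] (φ : Module.End R M) :
    ∃ P : R[X], P.Monic ∧ aeval φ P = 0 := by
  obtain ⟨P, hP, h0⟩ := LinearMap.exists_monic_and_aeval_eq_zero R (CharacterModule.dual φ)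
  exact ⟨P, hP, (dual_eq_zero_iff _).1 (by rw [dual_aeval, h0])⟩

end Dual

/-! ## §3 Descent to `V / c·V` -/

/-- **A monic annihilator modulo `c`.** `φ : A → A` linear over `S`, `V ⊆ A` a `φ`-stable submodule, `c ∈ S`; if the Pontryagin dual of
`V/c·V` is finitely generated over `S`, there is a monic `P ∈ S[Y]` with `P(φ) V ⊆ c·V`. [folklore] -/
theorem exists_monic_forall_exists_smul_eq_aeval {S A : Type*} [CommRing S] [AddCommGroup A] [Module S A]
    (φ : A →ₗ[S] A) (c : S) (V : Submodule S A) (hV : ∀ v ∈ V, φ v ∈ V)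
    (hfin : Module.Finite S (CharacterModule (↥V ⧸ LinearMap.range (LinearMap.lsmul S ↥V c)))) :
    ∃ P : S[X], P.Monic ∧ ∀ v ∈ V, ∃ v₀ ∈ V, c • v₀ = aeval φ P v := by
  haveI := hfin
  set N : Submodule S ↥V := LinearMap.range (LinearMap.lsmul S ↥V c) with hN
  let φV : ↥V →ₗ[S] ↥V := φ.restrict hV
  have hNφ : N ≤ N.comap φV := by
    rintro _ ⟨v, rfl⟩
    refine ⟨φV v, ?_⟩
    simp only [LinearMap.lsmul_apply, map_smul]
  let φQ : (↥V ⧸ N) →ₗ[S] (↥V ⧸ N) := N.mapQ N φV hNφ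
  obtain ⟨P, hP, h0⟩ := exists_monic_aeval_eq_zero_of_finite_characterModule φQ
  refine ⟨P, hP, fun v hv => ?_⟩
  -- `mkQ ∘ P(φV) = P(φQ) ∘ mkQ = 0`, so `P(φV) v ∈ N = c·V`
  have hnat : N.mkQ ∘ₗ aeval φV P = aeval φQ P ∘ₗ N.mkQ :=
    comp_aeval_of_comp_eq N.mkQ φV φQ (by ext x; rfl) P
  have hmem : aeval φV P ⟨v, hv⟩ ∈ N := by
    rw [← Submodule.Quotient.mk_eq_zero, ← Submodule.mkQ_apply, ← LinearMap.comp_apply, hnat, h0,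
      LinearMap.zero_comp, LinearMap.zero_apply]
  obtain ⟨v₀, hv₀⟩ := hmem
  refine ⟨(v₀ : A), v₀.2, ?_⟩
  -- `subtype ∘ P(φV) = P(φ) ∘ subtype`
  have hsub : V.subtype ∘ₗ aeval φV P = aeval φ P ∘ₗ V.subtype :=
    comp_aeval_of_comp_eq V.subtype φV φ (by ext x; rfl) P
  have h1 := congrArg (fun f : ↥V →ₗ[S] A => f ⟨v, hv⟩) hsub
  simp only [LinearMap.comp_apply, Submodule.subtype_apply] at h1
  rw [← h1, ← hv₀, LinearMap.lsmul_apply, Submodule.coe_smul]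

/-! ## §4 The (ann) clause of p752662 from cofinite generation of `A^{I_w}/c·A^{I_w}` -/

open Field IsDedekindDomain NumberField
open Literature.NumberTheory.GaloisRepresentations Literature.NumberTheory.EllipticCurves
  Literature.NumberTheory.EllipticCurves.BigGaloisRep

/-- **(ann) from cofinite generation.** `ρ : Γ_K → Aut_S(A)` a continuous representation, `c ∈ S`, `w` a finite place, `d ∈ Γ_{K_w}`;
`V = A^{I_w}` the submodule of vectors fixed by `ρ(res h)` for all `h` in the inertia group at `w` (`localMap K (Sum.inr w)`). If the
Pontryagin dual of `V/c·V` is a finitely generated `S`-module, then there is a MONIC `P ∈ S[Y]` such that every `a ∈ A^{I_w}` has an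
`a₀ ∈ A^{I_w}` with `c • a₀ = P(ρ(res d)) a` — the (ann) input of
`TelescopeK2WeightTwoControlMapOfFrobenius.exists_weightTwoControlMap_of_frobenius_of_heegner`
at `(w, d)`, in its quantifier shape. (`ρ(res d)` preserves `A^{I_w}` because `I_w` is normal in `Γ_{K_w}`.)
[cite: JetchevSkinnerWan2017, §3.4, Lemma 3.4.1] [cite: BourbakiAC5to7, Alg. Comm. (Cayley–Hamilton)] -/
theorem frobeniusAnnihilator_of_finite {K : Type} [Field K] [NumberField K]
    {S : Type*} [CommRing S] [TopologicalSpace S] {A : Type*} [AddCommGroup A] [Module S A] [TopologicalSpace A]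
    (ρ : ContinuousRep (absoluteGaloisGroup K) S A) (c : S) (w : HeightOneSpectrum (𝓞 K)) (d : LocalGroup K (Sum.inl w))
    (hfin : Module.Finite S (CharacterModule
      (↥(⨅ h : LocalGroup K (Sum.inr w), LinearMap.eqLocus (ρ (localMap K (Sum.inr w) h)) LinearMap.id) ⧸
        LinearMap.range (LinearMap.lsmul S
          ↥(⨅ h : LocalGroup K (Sum.inr w), LinearMap.eqLocus (ρ (localMap K (Sum.inr w) h)) LinearMap.id) c)))) :
    ∃ P : S[X], P.Monic ∧
      ∀ a : A, (∀ h : LocalGroup K (Sum.inr w), ρ (localMap K (Sum.inr w) h) a = a) →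
        ∃ a₀ : A, (∀ h : LocalGroup K (Sum.inr w), ρ (localMap K (Sum.inr w) h) a₀ = a₀) ∧
          c • a₀ = (Polynomial.aeval (ρ (localMap K (Sum.inl w) d)) P) a := by
  set V : Submodule S A := ⨅ h : LocalGroup K (Sum.inr w), LinearMap.eqLocus (ρ (localMap K (Sum.inr w) h)) LinearMap.id
    with hVdef
  have hmemV : ∀ a : A, a ∈ V ↔ ∀ h : LocalGroup K (Sum.inr w), ρ (localMap K (Sum.inr w) h) a = a := by
    intro a
    simp only [hVdef, Submodule.mem_iInf, LinearMap.mem_eqLocus, LinearMap.id_apply]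
  -- `ρ(res d)` preserves `V`: for `h ∈ I_w`, `h·d = d·(d⁻¹ h d)` with `d⁻¹ h d ∈ I_w`
  haveI : (absInertia (w.adicCompletion K)).Normal := absInertia_normal_holds (w.adicCompletion K)
  have hV : ∀ v ∈ V, ρ (localMap K (Sum.inl w) d) v ∈ V := by
    intro v hv
    rw [hmemV] at hv ⊢
    intro h
    -- read `h` in `I_w ≤ Γ_{K_w}` and `d` in `Γ_{K_w}`
    let h' : ↥(absInertia (w.adicCompletion K)) := h
    let d' : absoluteGaloisGroup (w.adicCompletion K) := d
    have hn : (d'⁻¹ * (h' : absoluteGaloisGroup (w.adicCompletion K)) * d') ∈ absInertia (w.adicCompletion K) := by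
      simpa using (inferInstance : (absInertia (w.adicCompletion K)).Normal).conj_mem _ h'.2 d'⁻¹
    have hprod : localMap K (Sum.inr w) h * localMap K (Sum.inl w) d =
        localMap K (Sum.inl w) d * localMap K (Sum.inr w)
          (show LocalGroup K (Sum.inr w) from (⟨_, hn⟩ : ↥(absInertia (w.adicCompletion K)))) := by
      change absGaloisRestrict K (w.adicCompletion K) (h' : absoluteGaloisGroup (w.adicCompletion K)) *
          absGaloisRestrict K (w.adicCompletion K) d' =
        absGaloisRestrict K (w.adicCompletion K) d' *
          absGaloisRestrict K (w.adicCompletion K) (d'⁻¹ * (h' : absoluteGaloisGroup (w.adicCompletion K)) * d')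
      rw [← map_mul, ← map_mul, ← mul_assoc, ← mul_assoc, mul_inv_cancel, one_mul]
    have h1 : ρ (localMap K (Sum.inr w) h) (ρ (localMap K (Sum.inl w) d) v) =
        (ρ (localMap K (Sum.inr w) h * localMap K (Sum.inl w) d)) v := by
      rw [map_mul, Module.End.mul_apply]
    rw [h1, hprod, map_mul, Module.End.mul_apply, hv]
  obtain ⟨P, hP, hPV⟩ := exists_monic_forall_exists_smul_eq_aeval (ρ (localMap K (Sum.inl w) d)) c V hV hfin
  refine ⟨P, hP, fun a ha => ?_⟩
  obtain ⟨a₀, ha₀, h⟩ := hPV a ((hmemV a).2 ha)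
  exact ⟨a₀, (hmemV a₀).1 ha₀, h⟩

end Summit.BirchSwinnertonDyer.BirchSwinnertonDyer.Theorems.TelescopeK2FrobeniusAnnihilator

end
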